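import Literature.Analysis.FluidPDE.GCLMViscousSelfSimilarAnsatz
import HarnessLib

/-!
# SHEET-ℝ decay law: a power-law tail of a profile of the steady viscous gCLM equation has exponent `p = 2`

HONEST FRAMING (cell ns-blowup GROUP B / zone Z3, case Z3-SR-CERT; 1-D MODEL (viscous gCLM self-similar profile on the line); not Euler/NS).

Companion of `SheetROriginLaw.lean` at the other end of the line. For the typed steady equation `ViscousGCLMProfileEqAt a ν Ω X`
(`(X/2 + a·U)·Ω′ = (−1 + HΩ)·Ω + ν·Ω″`, `GCLMViscousSelfSimilarAnsatz.lean`) divide by `Ω` and let `X → +∞`: if the profile has a power-law tail in the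
sense `X·Ω′(X)/Ω(X) → −p`, while `U(X)/X → 0`, `HΩ(X) → 0` and `Ω″(X)/Ω(X) → 0` (all three hold for an odd profile with `Ω ~ A·X^{−p}`, `U ~ (2A/π)log X/X`-type
velocity and `HΩ = O(log X/X²)` — the cell's FARFIELD-NOTE (F1)–(F3), (F8)), then `½·p = 1`, i.e. **`p = 2`**: the far field `Ω ~ A·ξ⁻²` of the SHEET-ℝ frame
(selfsim g5 FARFIELD-NOTE F1, eng-3/eng-5 measured `A = −21.818` at `a = 0.2`) is forced by the equation, exactly as the antipodal order is forced on the
circle (`OSWAprioriWindow.antipode_identity`). General transport coefficient: `cl·p = 1` (`decay_law`; so `p = 3` on the `c_l = ⅓` row, matching the exact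
family `Ω_a ∝ x/(1+x²)² ~ ξ⁻³` of `SheetRowThirdExactFamily`). Pure limits; MODEL statement; no definition, no named fact, nothing about existence.
-/

noncomputable section

namespace Summit.NavierStokesRegularity.OSWSelfSimilar
namespace SheetRDecayLaw

open _root_.Set _root_.Filter Literature.Analysis.FluidPDE
open scoped Real Topology

/-- **DECAY LAW (pure limits).** If the profile equation `(cl·x + a·g(x))·f′(x) = (−1 + h(x))·f(x) + ν·f″(x)` holds for all large `x` with `f ≠ 0`,
and as `x → +∞`: `x·f′(x)/f(x) → −p`, `g(x)/x → 0`, `h(x) → 0`, `f″(x)/f(x) → 0`, then `cl·p = 1`. [folklore] -/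
theorem decay_law {a ν cl p R : ℝ} {f f' f'' g h : ℝ → ℝ}
    (hEq : ∀ x, R < x → (cl * x + a * g x) * f' x = (-1 + h x) * f x + ν * f'' x)
    (hf0 : ∀ x, R < x → f x ≠ 0)
    (hp : Tendsto (fun x => x * f' x / f x) atTop (𝓝 (-p)))
    (hg : Tendsto (fun x => g x / x) atTop (𝓝 0)) (hh : Tendsto h atTop (𝓝 0))
    (hf'' : Tendsto (fun x => f'' x / f x) atTop (𝓝 0)) : cl * p = 1 := by
  -- left side divided by `f`: (cl + a g/x)·(x f′/f) → (cl + 0)·(−p); right side: −1 + h + ν f″/f → −1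
  have hL : Tendsto (fun x => (cl + a * (g x / x)) * (x * f' x / f x)) atTop (𝓝 ((cl + a * 0) * (-p))) :=
    (tendsto_const_nhds.add (hg.const_mul a)).mul hp
  have hR : Tendsto (fun x => -1 + h x + ν * (f'' x / f x)) atTop (𝓝 (-1 + 0 + ν * 0)) :=
    (tendsto_const_nhds.add hh).add (hf''.const_mul ν)
  have heq : ∀ᶠ x in atTop, (cl + a * (g x / x)) * (x * f' x / f x) = -1 + h x + ν * (f'' x / f x) := by
    filter_upwards [eventually_gt_atTop (max R 0)] with x hx
    have hxR : R < x := lt_of_le_of_lt (le_max_left _ _) hx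
    have hx0 : x ≠ 0 := ne_of_gt (lt_of_le_of_lt (le_max_right _ _) hx)
    have hfx : f x ≠ 0 := hf0 x hxR
    have e := hEq x hxR
    rw [show (cl + a * (g x / x)) * (x * f' x / f x) = ((cl * x + a * g x) * f' x) / f x by field_simp]
    rw [e]
    field_simp
  have := tendsto_nhds_unique (hL.congr' heq) hR
  simp only [mul_zero, add_zero] at this
  linear_combination (-1 : ℝ) * this

/-- **DECAY LAW for the typed SHEET-ℝ equation:** a solution of `ViscousGCLMProfileEqAt a ν Ω X` for all large `X` with `Ω ≠ 0` there and a power-law tail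
(`X·Ω′/Ω → −p`) along which `U(X)/X → 0`, `HΩ(X) → 0`, `Ω″/Ω → 0`, has `p = 2`: the far field of the parabolic-gauge profile is `Ω ~ A·ξ⁻²`. [folklore] -/
theorem decay_exponent_eq_two {a ν p R : ℝ} {Ω : ℝ → ℝ}
    (hP : ∀ X, R < X → ViscousGCLMProfileEqAt a ν Ω X) (hΩ0 : ∀ X, R < X → Ω X ≠ 0)
    (hp : Tendsto (fun X => X * deriv Ω X / Ω X) atTop (𝓝 (-p)))
    (hU : Tendsto (fun X => lineVelocity Ω X / X) atTop (𝓝 0)) (hH : Tendsto (lineHilbert Ω) atTop (𝓝 0))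
    (hd2 : Tendsto (fun X => iteratedDeriv 2 Ω X / Ω X) atTop (𝓝 0)) : p = 2 := by
  have h := decay_law (cl := 1 / 2) (f := Ω) (f' := deriv Ω) (f'' := fun X => iteratedDeriv 2 Ω X) (g := lineVelocity Ω)
    (h := lineHilbert Ω) (fun X hX => (viscousGCLMProfileEqAt_iff a ν Ω X).mp (hP X hX)) hΩ0 hp hU hH hd2
  linarith

/-- The same for a general self-similar gauge written as `cl·X·Ω′` transport (e.g. the `c_l = ⅓` row of the sheet: `p = 3`, the decay of the exact family
`Ω_a ∝ x/(1 + x²)²`): `p = 1/cl`. [folklore] -/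
theorem decay_exponent_eq_inv {a ν cl p R : ℝ} {f f' f'' g h : ℝ → ℝ} (hcl : cl ≠ 0)
    (hEq : ∀ x, R < x → (cl * x + a * g x) * f' x = (-1 + h x) * f x + ν * f'' x)
    (hf0 : ∀ x, R < x → f x ≠ 0)
    (hp : Tendsto (fun x => x * f' x / f x) atTop (𝓝 (-p)))
    (hg : Tendsto (fun x => g x / x) atTop (𝓝 0)) (hh : Tendsto h atTop (𝓝 0))
    (hf'' : Tendsto (fun x => f'' x / f x) atTop (𝓝 0)) : p = 1 / cl := by
  have h := decay_law hEq hf0 hp hg hh hf''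
  field_simp
  linarith

end SheetRDecayLaw
end Summit.NavierStokesRegularity.OSWSelfSimilar

end
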